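import Summits.BirchSwinnertonDyer.BirchSwinnertonDyer.Theorems.ByReductionTypeAtTwoRankOneAtTwoBigImageOddLocalOneDoorFullC
import Summits.BirchSwinnertonDyer.BirchSwinnertonDyer.Theorems.ByReductionTypeAtTwoRankOneAtTwoBigImageOddLocalOneDoorTamagawa
import Summits.BirchSwinnertonDyer.BirchSwinnertonDyer.Theorems.ByReductionTypeAtTwoRankOneAtTwoBigImageOddLocalOneDoorAnalyticGlue
import HarnessLib

/-!
# Route `ByReductionTypeAtTwo`, crux `RankOneAtTwoOffBigImageOddLocal` (stmt-BirchSwinnertonDyer-23716), line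
# `refined_kolyvagin_tamagawa_shift_at_two`: the γ KERNEL — the per-datum door iff with `E(ℚ)[2] = 0` only and the Tamagawa valuation carried

Lead prover `prover-cruxlead-stmt-BirchSwinnertonDyer-23716-g0` (2026-08-28).  §1 of the registered skeleton
`Cruxes/RankOneAtTwoOffBigImageOddLocal/Lines/refined_kolyvagin_tamagawa_shift_at_two.lean` (g6), landed as a `--supports` helper of the crux:
`bsdp_two_iff_doorLawFullCT_at` — the sibling crux's `RankOneAtTwoOneDoor.bsdp_two_iff_doorLawFullC_at` (lead fkl-p1 g7, p621746) with the
slice binders `Odd W.torsionOrder`, `Odd W.tamagawaProduct` REPLACED by `NoRationalTwoTorsion W` (odd torsion is then a theorem,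
`odd_torsionOrder_of_two_smul_eq_zero`) and the law's right-hand side CARRYING `+ 2·v₂ ∏ c_ℓ(W)` (the valuation of the twin's BSD quotient
already contains it; p621746 merely zeroed it with `Odd ∏c`); the Tamagawa receptacle `DoorTwistTamagawaAtTwo` is DISCHARGED here by the
tree theorem `doorTwistTamagawaAtTwo` (one hypothesis fewer than the skeleton's §1).  No hypothesis on the `2`-adic image: this is the
E-side currency of BOTH γ faces of the line (`stub_gamma1LawOddC`, `stub_gamma1LawEvenC`) and of every E-chart socket of its atlas.

Statement.  `W/ℚ` globally minimal with `E(ℚ)[2] = 0` and analytic rank `1`; `K` imaginary quadratic with `d_K` door-admissible, Heegner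
hypothesis for `N_E`, `L(E^{(d_K)},1) ≠ 0`; ANY parametrisation datum `Dt` (constant `c ≠ 0`, no parity), `H`, `ι`, `P ∈ E(K)` mapping to
the complex Heegner point; a globally minimal model `Wd` of the twist with `BSD(Wd, 2)`; published inputs Gross–Zagier / Kolyvagin at
`(N_E, W, K)`, GZK, modularity (named facts, hypotheses).  THEN `Ш(W)[2^∞]`, `Ш(Wd)[2^∞]` are finite and
`BSD(W,2) ⟺ ∃ m, 2^m ∥ P in E(K)/tors ∧ 2m + [Δ<0] = s_W + s_d + t + 2s + 2·v₂ c(Dt) + 2·v₂ ∏c_ℓ(W)`.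
Proof = p621746's, verbatim up to the two binder changes (the PROVED tree door `P2.bsdp_two_iff_of_heegner_rankOne`, the exact
`2`-divisibility exponent of a rank-one generator, `w_K = 2`, `|u| = 1`, the sign/real-components bookkeeping).
BSD is not proved by this; the crux is not proved by this (its seven registered stubs are untouched); conditional on the named print
facts it takes as hypotheses, exactly like p621746.

References: [GrossZagier1986] Thm. I.6.3 and V.§2; [Pal2012] Prop. 2.5 and Cor. 2.6; [Miller2011LMS] Def. 1.1; [Kramer1981] Prop. 3.
-/

set_option linter.dupNamespace false -- tree convention: `Summit.BirchSwinnertonDyer.BirchSwinnertonDyer.Theorems` (summit = sub-problem)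
set_option autoImplicit false
noncomputable section

open scoped Classical

namespace Summit.BirchSwinnertonDyer.BirchSwinnertonDyer.Theorems.OffBigImageOddLocalAtTwo

open WeierstrassCurve NumberField IsDedekindDomain Rat.HeightOneSpectrum Literature.NumberTheory.EllipticCurves
  Literature.NumberTheory.EllipticCurves.ModularForms
  Literature.NumberTheory.EllipticCurves.Rank1Residual
  Literature.NumberTheory.EllipticCurves.Rank1Residual.Typed
  Literature.NumberTheory.EllipticCurves.KrizLi2019
  Summit.BirchSwinnertonDyer.Rank1Residual
  Summit.BirchSwinnertonDyer.Rank1Residual.AdditivePotMult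
  Summit.BirchSwinnertonDyer.Rank1Residual.F1Sign2
  Summit.BirchSwinnertonDyer.Rank1Residual.F1Sign2.TranspositionDoor
  Summit.BirchSwinnertonDyer.BirchSwinnertonDyer.Theorems.RankOneAtTwoOneDoor

/-- **The FULL door law, constant AND Tamagawa valuation floating, is an EQUIVALENCE at every non-vanishing door datum.**
`bsdp_two_iff_doorLawFullC_at` (lead fkl-p1 g7, p621746) VERBATIM except: the binders `Odd W.torsionOrder`, `Odd W.tamagawaProduct`
are replaced by `NoRationalTwoTorsion W` (odd torsion is then a theorem, `odd_torsionOrder_of_two_smul_eq_zero`), and the right-hand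
side of the law carries `+ 2·v₂ ∏ c_ℓ(W)` (the valuation `hvqd` of the twin's BSD quotient already contains it; p621746 merely zeroed
it).  No hypothesis on the `2`-adic image.  [cite: GrossZagier1986, Thm. I.6.3 and V.§2] [cite: Pal2012, Prop. 2.5 and Cor. 2.6] -/
theorem bsdp_two_iff_doorLawFullCT_at
    (hGZK : rank_eq_analyticRank_of_analyticRank_le_one) (hmod : hasEntireLFunction_rat)
    (W : WeierstrassCurve ℚ) [W.IsElliptic] [W.IsGloballyMinimal] [NeZero (W.conductorNorm ℤ)]
    (hT2 : NoRationalTwoTorsion W) (hr : W.analyticRank = 1)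
    (K : Type) [Field K] [NumberField K] (hK : IsImaginaryQuadratic K)
    (hGZ : gross_zagier (W.conductorNorm ℤ) W K) (hKo : kolyvagin (W.conductorNorm ℤ) W K)
    (hadm : DoorAdmissible W (NumberField.discr K))
    (hHN : SatisfiesHeegnerHypothesis (W.conductorNorm ℤ) K)
    (hLt : (W.quadraticTwist (NumberField.discr K : ℚ)).entireLFunction 1 ≠ 0)
    (Dt : ModularParametrizationData W (W.conductorNorm ℤ))
    (H : HeegnerDatum (W.conductorNorm ℤ) (NumberField.discr K)) (ι : K →+* ℂ)
    (P : (W.baseChange K).toAffine.Point)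
    (hP : WeierstrassCurve.Affine.Point.map ι.toRatAlgHom P = heegnerPointComplex Dt H)
    (Wd : WeierstrassCurve ℚ) [Wd.IsElliptic] [Wd.IsGloballyMinimal] (Cd : VariableChange ℚ)
    (hWd : Cd • W.quadraticTwist (NumberField.discr K : ℚ) = Wd) (hBd : BSDp Wd 2) :
    Finite (AddCommGroup.primaryComponent W.sha 2) ∧ Finite (AddCommGroup.primaryComponent Wd.sha 2) ∧
      (BSDp W 2 ↔
        ∃ m : ℕ, HasTwoDivisibilityUpToTorsion W K P m ∧
          2 * m + (if W.Δ < 0 then 1 else 0) =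
            padicValNat 2 (Nat.card (AddCommGroup.primaryComponent W.sha 2)) +
              padicValNat 2 (Nat.card (AddCommGroup.primaryComponent Wd.sha 2)) +
              transpCount W (NumberField.discr K) + 2 * identCount W (NumberField.discr K) +
              2 * padicValInt 2 Dt.c + 2 * padicValNat 2 W.tamagawaProduct) := by
  haveI : Fact (Nat.Prime 2) := ⟨Nat.prime_two⟩
  have hTam : DoorTwistTamagawaAtTwo := doorTwistTamagawaAtTwo
  -- `V(ℚ)[2] = 0` forces `#V(ℚ)_tors` odd (Cauchy in `V(ℚ)_tors`; = `RankOneAtTwoOneDoor.odd_torsionOrder_of_two_smul_eq_zero`, inlined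
  -- so that this module stays out of the theses-cone of `…OneDoorValue`)
  have hoddT : ∀ (V : WeierstrassCurve ℚ) [V.IsElliptic], (∀ T : V.toAffine.Point, 2 • T = 0 → T = 0) → Odd V.torsionOrder := by
    intro V _ hV
    rw [← Nat.not_even_iff_odd, even_iff_two_dvd]
    intro hdvd
    obtain ⟨T, hT⟩ := exists_addOrderOf_eq_of_dvd_torsionOrder V 2 hdvd
    have h2T : 2 • T = 0 := by
      have h := addOrderOf_nsmul_eq_zero T
      rwa [hT] at h
    rw [hV T h2T, addOrderOf_zero] at hT
    exact absurd hT (by norm_num)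
  have hW2 : ∀ T : W.toAffine.Point, 2 • T = 0 → T = 0 := EggDoubling.eq_zero_of_two_smul_eq_zero W hT2
  have hT : Odd W.torsionOrder := hoddT W hW2
  have h2 : Module.finrank ℚ K = 2 := hK.1
  haveI : IsTotallyComplex K := hK.2
  -- the twist model: `L(Wd,1) ≠ 0`, analytic rank `0`, `BSD(Wd,2)` unpacked in rank `0`
  have hD0 : (NumberField.discr K : ℚ) ≠ 0 := by exact_mod_cast NumberField.discr_ne_zero K
  haveI hEt : (W.quadraticTwist (NumberField.discr K : ℚ)).IsElliptic := W.isElliptic_quadraticTwist hD0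
  have hLeq : Wd.entireLFunction = (W.quadraticTwist (NumberField.discr K : ℚ)).entireLFunction := by
    rw [← hWd, entireLFunction_smul]
  have hLd : Wd.entireLFunction 1 ≠ 0 := by rw [hLeq]; exact hLt
  have hrd : Wd.analyticRank = 0 := (Wd.analyticRank_eq_zero_iff_holds (hmod Wd)).2 hLd
  obtain ⟨hrankd, hfind, q', hq', hv'⟩ := hBd
  haveI := hfind
  have hrkd : Wd.mordellWeilRank = 0 := by rw [hrankd, hrd]
  -- `Wd(ℚ)[2] = 0` (twist invariance of `E(ℚ)[2] = 0`), hence `#Wd(ℚ)_tors` odd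
  have hWd2 : ∀ T : Wd.toAffine.Point, 2 • T = 0 → T = 0 := by
    have hbotW : AddSubgroup.torsionBy W.toAffine.Point (2 : ℤ) = ⊥ :=
      Summit.BirchSwinnertonDyer.Uniform.U2.torsionBy_two_eq_bot_iff.mpr hW2
    have hbotWd := Summit.BirchSwinnertonDyer.Uniform.U2.torsionBy_two_eq_bot_of_twist W hD0 Wd ⟨Cd⁻¹, by
      rw [← hWd, inv_smul_smul]⟩ hbotW
    exact Summit.BirchSwinnertonDyer.Uniform.U2.torsionBy_two_eq_bot_iff.mp hbotWd
  have hTdodd : Odd Wd.torsionOrder := hoddT Wd hWd2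
  have hvTd : padicValNat 2 Wd.torsionOrder = 0 :=
    padicValNat.eq_zero_of_not_dvd (fun h => (Nat.not_even_iff_odd.mpr hTdodd) (even_iff_two_dvd.mpr h))
  -- the value `q_d = L(Wd,1)/Ω(Wd)` and its valuation `s_d + ord₂ ∏c_ℓ(Wd) - 2 ord₂ #T`
  have hlead : Wd.leadingLCoeff = Wd.entireLFunction 1 :=
    WeierstrassCurve.leadingLCoeff_eq_of_analyticRank_eq_zero Wd hrd
  have hreg : Wd.regulator = 1 := Wd.regulator_eq_one_of_rank_zero hrkd
  have hΩdpos : 0 < Wd.realPeriodRat := Wd.realPeriodRat_pos_holds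
  have hΩdC : (Wd.realPeriodRat : ℂ) ≠ 0 := by exact_mod_cast hΩdpos.ne'
  have hTd0 : 0 < Wd.torsionOrder := Wd.torsionOrder_pos_holds
  have hcd0 : 0 < Wd.tamagawaProduct := Wd.tamagawaProduct_pos_holds
  set qd : ℚ := q' * Wd.tamagawaProduct / (Wd.torsionOrder : ℚ) ^ 2 with hqd_def
  have hsha := hq'
  rw [shaAn_def, hlead, hreg, Complex.ofReal_one, mul_one] at hsha
  have hqd : Wd.entireLFunction 1 / (Wd.realPeriodRat : ℂ) = (qd : ℂ) := by
    have hTC : (Wd.torsionOrder : ℂ) ≠ 0 := by exact_mod_cast hTd0.ne'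
    have hcC : (Wd.tamagawaProduct : ℂ) ≠ 0 := by exact_mod_cast hcd0.ne'
    have h1 : Wd.entireLFunction 1 * (Wd.torsionOrder : ℂ) ^ 2 =
        (q' : ℂ) * ((Wd.realPeriodRat : ℂ) * (Wd.tamagawaProduct : ℂ)) := by
      rw [← hsha]; field_simp
    rw [hqd_def]
    push_cast
    field_simp
    linear_combination h1
  have hq'0 : q' ≠ 0 := by
    intro h0
    apply hLd
    have := hqd
    rw [hqd_def, h0, zero_mul, zero_div, Rat.cast_zero, div_eq_zero_iff] at this
    rcases this with h | h
    · exact h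
    · exact absurd h hΩdC
  have hTq : (Wd.torsionOrder : ℚ) ≠ 0 := by exact_mod_cast hTd0.ne'
  have hcq : (Wd.tamagawaProduct : ℚ) ≠ 0 := by exact_mod_cast hcd0.ne'
  have hqd0 : qd ≠ 0 := by
    rw [hqd_def]; exact div_ne_zero (mul_ne_zero hq'0 hcq) (pow_ne_zero _ hTq)
  have hvqd : padicValRat 2 qd =
      (padicValNat 2 (Nat.card (AddCommGroup.primaryComponent Wd.sha 2)) : ℤ) +
        padicValNat 2 W.tamagawaProduct + transpCount W (NumberField.discr K) + 2 * identCount W (NumberField.discr K) := by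
    rw [hqd_def, padicValRat.div (mul_ne_zero hq'0 hcq) (pow_ne_zero _ hTq), padicValRat.mul hq'0 hcq,
      padicValRat.pow, padicValRat.of_nat, padicValRat.of_nat, hv', hvTd, hTam W (NumberField.discr K) hadm Wd Cd hWd]
    push_cast
    ring
  have hc0 : Dt.c ≠ 0 := Dt.maninConstant_ne_zero_holds
  -- the door
  obtain ⟨k, hk12, hkiff, hdoor⟩ :=
    P2.bsdp_two_iff_of_heegner_rankOne W (W.conductorNorm ℤ) K Dt H ι P hGZ hKo hGZK hmod hK hHN hP hc0 hr hLt Wd Cd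
      hWd qd hqd
  ------------------------------------------------------------------ rank `E(K) = 1`, `Ш(E)` finite
  haveI hEK : (W.baseChange K).IsElliptic := isElliptic_baseChange' W K
  have hL0 : W.entireLFunction 1 = 0 := entireLFunction_one_eq_zero_of_analyticRank_eq_one hr
  obtain ⟨-, hderiv⟩ := leadingLCoeff_eq_deriv_of_analyticRank_eq_one hr
  have hprod := lDerivEK_eq_deriv_mul W K hmod hL0
  have hLK : LDerivEK W K ≠ 0 := by rw [hprod]; exact mul_ne_zero hderiv hLt
  have hPH : IsHeegnerPoint (W.conductorNorm ℤ) W K P := ⟨Dt, H, ι, hP⟩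
  have hPinf : ¬ IsOfFinAddOrder P :=
    (lDerivEK_ne_zero_iff_not_isOfFinAddOrder W (W.conductorNorm ℤ) K hGZ hK hHN hPH).mp hLK
  obtain ⟨hrkK, hShaK⟩ := hKo hK hHN hPH hPinf
  have hShaW : W.ShaFinite := Literature.NumberTheory.EllipticCurves.shaFinite_of_baseChange W K hShaK
  haveI hfinW : Finite W.sha := hShaW
  have hfin2 : Finite (AddCommGroup.primaryComponent W.sha 2) := inferInstance
  have hrk : W.mordellWeilRank = 1 := by rw [(hGZK W (le_of_eq hr)).1, hr]
  ------------------------------------------------------------------ `#E(K)_tors` odd, `k = 1`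
  have htKodd : Odd (W.baseChange K).torsionOrder := odd_torsionOrder_baseChange_of_noRationalTwoTorsion W hT2 K h2
  have hk1 : k = 1 := by
    rcases hk12 with h | h
    · exact h
    · exact absurd (hkiff.mp h) (P2.not_forall_halvable_of_odd_torsionOrder W K h2 hrkK hrk htKodd)
  have hvtK : padicValNat 2 (W.baseChange K).torsionOrder = 0 :=
    padicValNat.eq_zero_of_not_dvd (fun h => (Nat.not_even_iff_odd.mpr htKodd) (even_iff_two_dvd.mpr h))
  ------------------------------------------------------------------ the generator of `E(K)/tors`
  obtain ⟨gK, hgK, hgenK, huniqK, -⟩ :=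
    exists_generator_regulator_eq_of_mordellWeilRank_eq_one (W.baseChange K) hrkK
  ------------------------------------------------------------------ `w_K = 2`, `|u| = 1`, oddness
  have hw2 : Units.torsionOrder K = 2 :=
    Literature.NumberTheory.QuadraticFields.Quadratic.torsionOrder_eq_two_of_discr_lt_neg_four h2
      (discr_lt_neg_four_of_doorAdmissible hadm)
  have hu1 : |(Cd.u : ℚ)| = 1 := by
    rcases W.u_eq_one_or_eq_neg_one_of_smul_quadraticTwist_of_squarefree (emod_four_of_doorAdmissible hadm)
        hadm.2.1 (good_or_mult_at_dvd_of_doorAdmissible W hadm) Wd Cd hWd with h | h <;> rw [h] <;> simp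
  ------------------------------------------------------------------ the valuation, for ANY exponent `m` of `P`
  have hΔ0 : W.Δ ≠ 0 := W.isUnit_Δ.ne_zero
  have htW' : (W.torsionOrder : ℚ) ≠ 0 := by exact_mod_cast (W.torsionOrder_pos_holds).ne'
  have htK' : ((W.baseChange K).torsionOrder : ℚ) ≠ 0 := by
    exact_mod_cast ((W.baseChange K).torsionOrder_pos_holds).ne'
  have hcW' : (W.tamagawaProduct : ℚ) ≠ 0 := by exact_mod_cast (W.tamagawaProduct_pos_holds).ne'
  have hcM : (Dt.c : ℚ) ≠ 0 := by exact_mod_cast hc0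
  have hw' : (Units.torsionOrder K : ℚ) ≠ 0 := by rw [hw2]; norm_num
  have hua : |(Cd.u : ℚ)| ≠ 0 := abs_ne_zero.mpr Cd.u.ne_zero
  have hk' : ((k : ℕ) : ℚ) ≠ 0 := by rw [hk1]; norm_num
  have hn12 : (W.baseChange ℝ).numRealComponents = 1 ∨ (W.baseChange ℝ).numRealComponents = 2 :=
    numRealComponents_eq_one_or W
  have hn' : ((W.baseChange ℝ).numRealComponents : ℚ) ≠ 0 := by
    rcases hn12 with h | h <;> rw [h] <;> norm_num
  have h8 : padicValRat 2 (8 : ℚ) = 3 := by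
    rw [show (8 : ℚ) = ((2 : ℕ) : ℚ) ^ 3 by norm_num, padicValRat.pow, padicValRat.self one_lt_two]; norm_num
  have hvtW : padicValRat 2 (W.torsionOrder : ℚ) = 0 := by
    rw [padicValRat.of_nat, padicValNat.eq_zero_of_not_dvd
      (fun h => (Nat.not_even_iff_odd.mpr hT) (even_iff_two_dvd.mpr h))]; rfl
  have hvtKq : padicValRat 2 ((W.baseChange K).torsionOrder : ℚ) = 0 := by
    rw [padicValRat.of_nat, hvtK]; rfl
  have hvcW : padicValRat 2 (W.tamagawaProduct : ℚ) = (padicValNat 2 W.tamagawaProduct : ℤ) := padicValRat.of_nat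
  have hvc : padicValRat 2 (Dt.c : ℚ) = (padicValInt 2 Dt.c : ℤ) := padicValRat.of_int
  have hvw : padicValRat 2 (Units.torsionOrder K : ℚ) = 1 := by
    rw [hw2]; exact padicValRat.self one_lt_two
  have hvu : padicValRat 2 |(Cd.u : ℚ)| = 0 := by rw [hu1]; exact padicValRat.one
  have hvk : padicValRat 2 ((k : ℕ) : ℚ) = 0 := by
    rw [hk1, Nat.cast_one]; exact padicValRat.one
  have hvqd' : padicValRat 2 qd =
      (padicValNat 2 (Nat.card (AddCommGroup.primaryComponent Wd.sha 2)) : ℤ) +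
        ((transpCount W (NumberField.discr K) : ℤ) + 2 * (identCount W (NumberField.discr K) : ℤ)) +
        (padicValNat 2 W.tamagawaProduct : ℤ) := by
    rw [hvqd]; push_cast; ring
  have hD1 : ((W.baseChange ℝ).numRealComponents : ℚ) * ((k : ℕ) : ℚ) ^ 2 ≠ 0 :=
    mul_ne_zero hn' (pow_ne_zero _ hk')
  have hD2 : ((W.baseChange ℝ).numRealComponents : ℚ) * ((k : ℕ) : ℚ) ^ 2 *
      ((W.baseChange K).torsionOrder : ℚ) ^ 2 ≠ 0 := mul_ne_zero hD1 (pow_ne_zero _ htK')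
  have hD3 : ((W.baseChange ℝ).numRealComponents : ℚ) * ((k : ℕ) : ℚ) ^ 2 *
      ((W.baseChange K).torsionOrder : ℚ) ^ 2 * (Dt.c : ℚ) ^ 2 ≠ 0 := mul_ne_zero hD2 (pow_ne_zero _ hcM)
  have hD4 : ((W.baseChange ℝ).numRealComponents : ℚ) * ((k : ℕ) : ℚ) ^ 2 *
      ((W.baseChange K).torsionOrder : ℚ) ^ 2 * (Dt.c : ℚ) ^ 2 * (Units.torsionOrder K : ℚ) ^ 2 ≠ 0 :=
    mul_ne_zero hD3 (pow_ne_zero _ hw')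
  have hD5 : ((W.baseChange ℝ).numRealComponents : ℚ) * ((k : ℕ) : ℚ) ^ 2 *
      ((W.baseChange K).torsionOrder : ℚ) ^ 2 * (Dt.c : ℚ) ^ 2 * (Units.torsionOrder K : ℚ) ^ 2 * qd ≠ 0 :=
    mul_ne_zero hD4 hqd0
  have hD6 : ((W.baseChange ℝ).numRealComponents : ℚ) * ((k : ℕ) : ℚ) ^ 2 *
      ((W.baseChange K).torsionOrder : ℚ) ^ 2 * (Dt.c : ℚ) ^ 2 * (Units.torsionOrder K : ℚ) ^ 2 * qd *
      |(Cd.u : ℚ)| ≠ 0 := mul_ne_zero hD5 hua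
  have hD7 : ((W.baseChange ℝ).numRealComponents : ℚ) * ((k : ℕ) : ℚ) ^ 2 *
      ((W.baseChange K).torsionOrder : ℚ) ^ 2 * (Dt.c : ℚ) ^ 2 * (Units.torsionOrder K : ℚ) ^ 2 * qd *
      |(Cd.u : ℚ)| * (W.tamagawaProduct : ℚ) ≠ 0 := mul_ne_zero hD6 hcW'
  have hden : padicValRat 2 (((W.baseChange ℝ).numRealComponents : ℚ) * ((k : ℕ) : ℚ) ^ 2 *
      ((W.baseChange K).torsionOrder : ℚ) ^ 2 * (Dt.c : ℚ) ^ 2 * (Units.torsionOrder K : ℚ) ^ 2 * qd *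
      |(Cd.u : ℚ)| * (W.tamagawaProduct : ℚ)) =
      padicValRat 2 ((W.baseChange ℝ).numRealComponents : ℚ) + 2 + 2 * (padicValInt 2 Dt.c : ℤ) +
        ((padicValNat 2 (Nat.card (AddCommGroup.primaryComponent Wd.sha 2)) : ℤ) +
          ((transpCount W (NumberField.discr K) : ℤ) + 2 * (identCount W (NumberField.discr K) : ℤ)) +
          (padicValNat 2 W.tamagawaProduct : ℤ)) + (padicValNat 2 W.tamagawaProduct : ℤ) := by
    rw [padicValRat.mul hD6 hcW', padicValRat.mul hD5 hua, padicValRat.mul hD4 hqd0,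
      padicValRat.mul hD3 (pow_ne_zero _ hw'), padicValRat.mul hD2 (pow_ne_zero _ hcM),
      padicValRat.mul hD1 (pow_ne_zero _ htK'), padicValRat.mul hn' (pow_ne_zero _ hk'),
      padicValRat.pow, padicValRat.pow, padicValRat.pow, padicValRat.pow,
      hvk, hvtKq, hvc, hvw, hvqd', hvu, hvcW]
    ring
  have hprim : padicValNat 2 (Nat.card (AddCommGroup.primaryComponent W.sha 2)) =
      padicValNat 2 (Nat.card W.sha) := padicValNat_card_addPrimaryComponent 2
  -- `[Δ<0]` and `v₂ n` add up to `1`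
  have hsign : padicValRat 2 ((W.baseChange ℝ).numRealComponents : ℚ) + (if W.Δ < 0 then 1 else 0 : ℕ) = 1 := by
    rcases lt_or_gt_of_ne hΔ0 with hneg | hpos
    · rw [if_pos hneg, P2.numRealComponents_eq_one_of_Δ_neg hneg, Nat.cast_one, padicValRat.one]; norm_num
    · rw [if_neg (not_lt.mpr hpos.le), P2.numRealComponents_eq_two_of_Δ_pos hpos, padicValRat.self one_lt_two]
      norm_num
  -- the valuation of the door's rational for a point with exponent `m`
  have hval : ∀ {m : ℕ} {Q : (W.baseChange K).toAffine.Point},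
      P - (2 ^ m) • Q ∈ AddCommGroup.torsion (W.baseChange K).toAffine.Point →
      (¬ ∃ Q' : (W.baseChange K).toAffine.Point,
          Q - 2 • Q' ∈ AddCommGroup.torsion (W.baseChange K).toAffine.Point) →
      padicValRat 2
          (8 * ((AddSubgroup.zmultiples P).index : ℚ) ^ 2 * (W.torsionOrder : ℚ) ^ 2 /
            (((W.baseChange ℝ).numRealComponents : ℚ) * (k : ℚ) ^ 2 *
              ((W.baseChange K).torsionOrder : ℚ) ^ 2 * (Dt.c : ℚ) ^ 2 *
              (Units.torsionOrder K : ℚ) ^ 2 * qd * |(Cd.u : ℚ)| * (W.tamagawaProduct : ℚ))) =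
        3 + 2 * (m : ℤ) - (padicValRat 2 ((W.baseChange ℝ).numRealComponents : ℚ) + 2 + 2 * (padicValInt 2 Dt.c : ℤ) +
          ((padicValNat 2 (Nat.card (AddCommGroup.primaryComponent Wd.sha 2)) : ℤ) +
            ((transpCount W (NumberField.discr K) : ℤ) + 2 * (identCount W (NumberField.discr K) : ℤ)) +
            (padicValNat 2 W.tamagawaProduct : ℤ)) + (padicValNat 2 W.tamagawaProduct : ℤ)) := by
    intro m Q hPQ hQ
    obtain ⟨hI0, hvIdx⟩ := padicValNat_index_of_twoDivisibility (W.baseChange K) hgK hgenK hPQ hQ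
    have hI' : ((AddSubgroup.zmultiples P).index : ℚ) ≠ 0 := by exact_mod_cast hI0
    have hvI : padicValRat 2 ((AddSubgroup.zmultiples P).index : ℚ) = (m : ℤ) := by
      rw [padicValRat.of_nat, hvIdx, hvtK]; push_cast; ring
    have hA1 : (8 : ℚ) * ((AddSubgroup.zmultiples P).index : ℚ) ^ 2 ≠ 0 :=
      mul_ne_zero (by norm_num) (pow_ne_zero _ hI')
    have hA2 : (8 : ℚ) * ((AddSubgroup.zmultiples P).index : ℚ) ^ 2 * (W.torsionOrder : ℚ) ^ 2 ≠ 0 :=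
      mul_ne_zero hA1 (pow_ne_zero _ htW')
    have hnum : padicValRat 2 ((8 : ℚ) * ((AddSubgroup.zmultiples P).index : ℚ) ^ 2 * (W.torsionOrder : ℚ) ^ 2) =
        3 + 2 * (m : ℤ) := by
      rw [padicValRat.mul hA1 (pow_ne_zero _ htW'), padicValRat.mul (by norm_num) (pow_ne_zero _ hI'),
        padicValRat.pow, padicValRat.pow, h8, hvI, hvtW]
      ring
    rw [padicValRat.div hA2 hD7, hnum, hden]
  refine ⟨hfin2, hfind, ?_⟩
  constructor
  · ---------------------------------------------------------------- BSD₂ ⇒ the law at the datum's own exponent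
    intro hB
    obtain ⟨m, Q, hPQ, hQ⟩ := exists_twoDivisibility_of_rankOne (W.baseChange K) hgenK huniqK hPinf
    refine ⟨m, ⟨Q, hPQ, hQ⟩, ?_⟩
    have hv := (hdoor.mp hB)
    rw [hval hPQ hQ, ← hprim] at hv
    have hv' := hsign
    zify
    push_cast at hv hv' ⊢
    linarith
  · ---------------------------------------------------------------- the law ⇒ BSD₂
    rintro ⟨m, ⟨Q, hPQ, hQ⟩, hlaw⟩
    apply hdoor.mpr
    have hQ' : ¬ ∃ Q' : (W.baseChange K).toAffine.Point,
        Q - 2 • Q' ∈ AddCommGroup.torsion (W.baseChange K).toAffine.Point := hQ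
    rw [hval hPQ hQ', ← hprim]
    have hlawZ : (2 * m : ℤ) + ((if W.Δ < 0 then 1 else 0 : ℕ) : ℤ) =
        (padicValNat 2 (Nat.card (AddCommGroup.primaryComponent W.sha 2)) : ℤ) +
          padicValNat 2 (Nat.card (AddCommGroup.primaryComponent Wd.sha 2)) +
          transpCount W (NumberField.discr K) + 2 * identCount W (NumberField.discr K) +
          2 * (padicValInt 2 Dt.c : ℤ) + 2 * (padicValNat 2 W.tamagawaProduct : ℤ) := by
      exact_mod_cast hlaw
    have hv' := hsign
    linarith

end Summit.BirchSwinnertonDyer.BirchSwinnertonDyer.Theorems.OffBigImageOddLocalAtTwo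

end
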